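import Literature.Topology.FourManifolds.SurfaceGroupGeneratorImages
import Mathlib.Tactic.Group
import HarnessLib

/-!
# The handle transvections `b_k ↦ b_k a_k^e` of the surface group `S_g`

Topic `Literature/Topology/FourManifolds`; companion of `SurfaceGroupCyclicShift.lean` and
`SurfaceGroupReflection.lean`, written for the Dehn–Nielsen–Baer seat (`DehnNielsenBaerSurface.lean`, item
W2.3-meridian: the action of the Dehn twist about the meridian `m₀` of the flower surface on the
melon marking).  The twist along the transversal arc of the `b₀`-loop inserts the meridian loop,
whose class is `a₀^{±1}`, at the base point; on the marking `ν` this is the automorphism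

  `b_k ↦ b_k · a_k^e`, all other generators fixed  (`k` the handle, `e = ±1`),

which descends to `S_g = ⟨a, b ∣ ∏ᵢ aᵢ bᵢ aᵢ⁻¹ bᵢ⁻¹⟩` for EVERY `e : ℤ` since
`a (b aᵉ) a⁻¹ (b aᵉ)⁻¹ = a b a⁻¹ b⁻¹` on the nose.  (With this relator convention the other side,
`b ↦ aᵉ b`, is NOT well defined for `g ≥ 2`: it conjugates only the `k`-th commutator.)

* `SurfaceGroup.transvGens`, `SurfaceGroup.transvEquiv k e : S_g ≃* S_g`, with `transvEquiv_a`,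
  `transvEquiv_b_self`, `transvEquiv_b_of_ne`, `transvEquiv_of`, and the inverse
  `transvEquiv_symm_apply = transvEquiv k (-e)` (`transvEquiv_neg_apply_transvEquiv`).
* The dual family `SurfaceGroup.transvAGens`, `SurfaceGroup.transvAEquiv k e : a_k ↦ a_k · b_k^e`,
  all other generators fixed (the action of the Dehn twist about the hole circle of the handle;
  `(a bᵉ) b (a bᵉ)⁻¹ b⁻¹ = a b a⁻¹ b⁻¹` on the nose, so again every `e : ℤ` descends), with
  `transvAEquiv_b`, `transvAEquiv_a_self`, `transvAEquiv_a_of_ne`, `transvAEquiv_symm_apply`,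
  `transvAEquiv_zero_apply`.

Everything is proved; no named facts (D-0026).

## References

* B. Farb, D. Margalit, *A primer on mapping class groups* (2012), §3.1.1 and Prop. 3.2 (the action
  of a Dehn twist on a curve crossing its annulus once), Thm. 4.1. [FarbMargalit2012]
* W. Magnus, A. Karrass, D. Solitar, *Combinatorial Group Theory* (1966), §3.7, Table 3.1 (`Δ₁`:
  `b₁ ↦ b₁ a₁`, the other generators fixed). [MagnusKarrassSolitar1966]
-/

noncomputable section

namespace Literature.Topology.FourManifolds

namespace SurfaceGroup

variable {g : ℕ}

/-- **The generator images of the handle transvection**: `b_k ↦ b_k a_k^e`, everything else fixed.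
[cite: FarbMargalit2012, Prop. 3.2] -/
def transvGens (k : Fin g) (e : ℤ) : surfaceGen g → SurfaceGroup g :=
  localGens a fun i => if i = k then b k * a k ^ e else b i

/-- `transvGens` on `a_i`. [folklore] -/
@[simp] theorem transvGens_false (k : Fin g) (e : ℤ) (i : Fin g) : transvGens k e (i, false) = a i := rfl

/-- `transvGens` on `b_k`. [folklore] -/
theorem transvGens_true_self (k : Fin g) (e : ℤ) : transvGens k e (k, true) = b k * a k ^ e := by
  simp [transvGens]

/-- `transvGens` on `b_i`, `i ≠ k`. [folklore] -/
theorem transvGens_true_of_ne (k : Fin g) (e : ℤ) {i : Fin g} (h : i ≠ k) : transvGens k e (i, true) = b i := by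
  simp [transvGens, h]

/-- **The transvected images kill the relator**: `a (b aᵉ) a⁻¹ (b aᵉ)⁻¹ = a b a⁻¹ b⁻¹`. [folklore] -/
theorem prod_relFactor_transvGens (k : Fin g) (e : ℤ) :
    ((List.range g).map (relFactor (transvGens k e))).prod = 1 := by
  refine prod_relFactor_localGens _ _ fun i => ?_
  by_cases hi : i = k
  · subst hi
    simp only [if_true]
    group
  · simp [hi]

/-- The transvection by `-e` undoes the transvection by `e` on the generators. [folklore] -/
theorem homOfGens_transvGens_neg (k : Fin g) (e : ℤ) (p : surfaceGen g) :
    homOfGens (transvGens k (-e)) (prod_relFactor_transvGens k (-e)) (transvGens k e p) =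
      PresentedGroup.of p := by
  obtain ⟨i, c⟩ := p
  cases c
  · rw [transvGens_false, homOfGens_a, transvGens_false]; rfl
  · by_cases hi : i = k
    · subst hi
      rw [transvGens_true_self, map_mul, map_zpow, homOfGens_a, homOfGens_b, transvGens_false,
        transvGens_true_self, mul_assoc, ← zpow_add, neg_add_cancel, zpow_zero, mul_one]
      rfl
    · rw [transvGens_true_of_ne _ _ hi, homOfGens_b, transvGens_true_of_ne _ _ hi]; rfl

/-- **The handle transvection `b_k ↦ b_k a_k^e`** as an automorphism of `S_g` (inverse: `e ↦ -e`).
[cite: FarbMargalit2012, Prop. 3.2] [cite: MagnusKarrassSolitar1966, §3.7 Table 3.1] -/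
def transvEquiv (k : Fin g) (e : ℤ) : SurfaceGroup g ≃* SurfaceGroup g :=
  equivOfGens (transvGens k e) (transvGens k (-e)) (prod_relFactor_transvGens k e)
    (prod_relFactor_transvGens k (-e)) (homOfGens_transvGens_neg k e) fun p => by
      have h := homOfGens_transvGens_neg k (-e) p
      rwa [neg_neg] at h

/-- `transvEquiv` on a generator. [folklore] -/
@[simp] theorem transvEquiv_of (k : Fin g) (e : ℤ) (p : surfaceGen g) :
    transvEquiv k e (PresentedGroup.of p) = transvGens k e p :=
  equivOfGens_of _ _ _ _ _ _ p

/-- `transvEquiv` fixes every `a_i`. [folklore] -/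
theorem transvEquiv_a (k : Fin g) (e : ℤ) (i : Fin g) : transvEquiv k e (a i) = a i :=
  transvEquiv_of k e (i, false)

/-- `transvEquiv` on `b_k`. [folklore] -/
theorem transvEquiv_b_self (k : Fin g) (e : ℤ) : transvEquiv k e (b k) = b k * a k ^ e :=
  (transvEquiv_of k e (k, true)).trans (transvGens_true_self k e)

/-- `transvEquiv` fixes `b_i` for `i ≠ k`. [folklore] -/
theorem transvEquiv_b_of_ne (k : Fin g) (e : ℤ) {i : Fin g} (h : i ≠ k) : transvEquiv k e (b i) = b i :=
  (transvEquiv_of k e (i, true)).trans (transvGens_true_of_ne k e h)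

/-- The inverse of `transvEquiv k e` on a generator is `transvEquiv k (-e)`. [folklore] -/
@[simp] theorem transvEquiv_symm_of (k : Fin g) (e : ℤ) (p : surfaceGen g) :
    (transvEquiv k e).symm (PresentedGroup.of p) = transvGens k (-e) p :=
  equivOfGens_symm_of _ _ _ _ _ _ p

/-- **The inverse transvection**: `(transvEquiv k e)⁻¹ = transvEquiv k (-e)`. [folklore] -/
theorem transvEquiv_symm_apply (k : Fin g) (e : ℤ) (x : SurfaceGroup g) :
    (transvEquiv k e).symm x = transvEquiv k (-e) x := by
  suffices h : (transvEquiv k e).symm.toMonoidHom = (transvEquiv k (-e)).toMonoidHom from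
    DFunLike.congr_fun h x
  exact PresentedGroup.ext fun p => by simp

/-- `transvEquiv k 0 = id`. [folklore] -/
theorem transvEquiv_zero_apply (k : Fin g) (x : SurfaceGroup g) : transvEquiv k 0 x = x := by
  suffices h : (transvEquiv k 0).toMonoidHom = MonoidHom.id _ from DFunLike.congr_fun h x
  refine PresentedGroup.ext fun p => ?_
  obtain ⟨i, c⟩ := p
  cases c
  · simp [a_def]
  · by_cases hi : i = k
    · subst hi; simp [transvGens_true_self, b_def]
    · simp [transvGens_true_of_ne _ _ hi, b_def]

/-! ### The dual handle transvections `a_k ↦ a_k b_k^e` -/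

/-- **The generator images of the dual handle transvection**: `a_k ↦ a_k b_k^e`, everything else
fixed (the action of the Dehn twist about the hole circle of the `k`-th handle).
[cite: FarbMargalit2012, Prop. 3.2] -/
def transvAGens (k : Fin g) (e : ℤ) : surfaceGen g → SurfaceGroup g :=
  localGens (fun i => if i = k then a k * b k ^ e else a i) b

/-- `transvAGens` on `b_i`. [folklore] -/
@[simp] theorem transvAGens_true (k : Fin g) (e : ℤ) (i : Fin g) : transvAGens k e (i, true) = b i := rfl

/-- `transvAGens` on `a_k`. [folklore] -/
theorem transvAGens_false_self (k : Fin g) (e : ℤ) : transvAGens k e (k, false) = a k * b k ^ e := by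
  simp [transvAGens]

/-- `transvAGens` on `a_i`, `i ≠ k`. [folklore] -/
theorem transvAGens_false_of_ne (k : Fin g) (e : ℤ) {i : Fin g} (h : i ≠ k) : transvAGens k e (i, false) = a i := by
  simp [transvAGens, h]

/-- **The dual transvected images kill the relator**: `(a bᵉ) b (a bᵉ)⁻¹ b⁻¹ = a b a⁻¹ b⁻¹`. [folklore] -/
theorem prod_relFactor_transvAGens (k : Fin g) (e : ℤ) :
    ((List.range g).map (relFactor (transvAGens k e))).prod = 1 := by
  refine prod_relFactor_localGens _ _ fun i => ?_
  by_cases hi : i = k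
  · subst hi
    simp only [if_true]
    group
  · simp [hi]

/-- The dual transvection by `-e` undoes the one by `e` on the generators. [folklore] -/
theorem homOfGens_transvAGens_neg (k : Fin g) (e : ℤ) (p : surfaceGen g) :
    homOfGens (transvAGens k (-e)) (prod_relFactor_transvAGens k (-e)) (transvAGens k e p) =
      PresentedGroup.of p := by
  obtain ⟨i, c⟩ := p
  cases c
  · by_cases hi : i = k
    · subst hi
      rw [transvAGens_false_self, map_mul, map_zpow, homOfGens_a, homOfGens_b, transvAGens_true,
        transvAGens_false_self, mul_assoc, ← zpow_add, neg_add_cancel, zpow_zero, mul_one]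
      rfl
    · rw [transvAGens_false_of_ne _ _ hi, homOfGens_a, transvAGens_false_of_ne _ _ hi]; rfl
  · rw [transvAGens_true, homOfGens_b, transvAGens_true]; rfl

/-- **The dual handle transvection `a_k ↦ a_k b_k^e`** as an automorphism of `S_g`
(inverse: `e ↦ -e`). [cite: FarbMargalit2012, Prop. 3.2] [cite: MagnusKarrassSolitar1966, §3.7 Table 3.1] -/
def transvAEquiv (k : Fin g) (e : ℤ) : SurfaceGroup g ≃* SurfaceGroup g :=
  equivOfGens (transvAGens k e) (transvAGens k (-e)) (prod_relFactor_transvAGens k e)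
    (prod_relFactor_transvAGens k (-e)) (homOfGens_transvAGens_neg k e) fun p => by
      have h := homOfGens_transvAGens_neg k (-e) p
      rwa [neg_neg] at h

/-- `transvAEquiv` on a generator. [folklore] -/
@[simp] theorem transvAEquiv_of (k : Fin g) (e : ℤ) (p : surfaceGen g) :
    transvAEquiv k e (PresentedGroup.of p) = transvAGens k e p :=
  equivOfGens_of _ _ _ _ _ _ p

/-- `transvAEquiv` fixes every `b_i`. [folklore] -/
theorem transvAEquiv_b (k : Fin g) (e : ℤ) (i : Fin g) : transvAEquiv k e (b i) = b i :=
  transvAEquiv_of k e (i, true)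

/-- `transvAEquiv` on `a_k`. [folklore] -/
theorem transvAEquiv_a_self (k : Fin g) (e : ℤ) : transvAEquiv k e (a k) = a k * b k ^ e :=
  (transvAEquiv_of k e (k, false)).trans (transvAGens_false_self k e)

/-- `transvAEquiv` fixes `a_i` for `i ≠ k`. [folklore] -/
theorem transvAEquiv_a_of_ne (k : Fin g) (e : ℤ) {i : Fin g} (h : i ≠ k) : transvAEquiv k e (a i) = a i :=
  (transvAEquiv_of k e (i, false)).trans (transvAGens_false_of_ne k e h)

/-- The inverse of `transvAEquiv k e` on a generator is `transvAEquiv k (-e)`. [folklore] -/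
@[simp] theorem transvAEquiv_symm_of (k : Fin g) (e : ℤ) (p : surfaceGen g) :
    (transvAEquiv k e).symm (PresentedGroup.of p) = transvAGens k (-e) p :=
  equivOfGens_symm_of _ _ _ _ _ _ p

/-- **The inverse dual transvection**: `(transvAEquiv k e)⁻¹ = transvAEquiv k (-e)`. [folklore] -/
theorem transvAEquiv_symm_apply (k : Fin g) (e : ℤ) (x : SurfaceGroup g) :
    (transvAEquiv k e).symm x = transvAEquiv k (-e) x := by
  suffices h : (transvAEquiv k e).symm.toMonoidHom = (transvAEquiv k (-e)).toMonoidHom from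
    DFunLike.congr_fun h x
  exact PresentedGroup.ext fun p => by simp

/-- `transvAEquiv k 0 = id`. [folklore] -/
theorem transvAEquiv_zero_apply (k : Fin g) (x : SurfaceGroup g) : transvAEquiv k 0 x = x := by
  suffices h : (transvAEquiv k 0).toMonoidHom = MonoidHom.id _ from DFunLike.congr_fun h x
  refine PresentedGroup.ext fun p => ?_
  obtain ⟨i, c⟩ := p
  cases c
  · by_cases hi : i = k
    · subst hi; simp [transvAGens_false_self, a_def]
    · simp [transvAGens_false_of_ne _ _ hi, a_def]
  · simp [b_def]

end SurfaceGroup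

end Literature.Topology.FourManifolds

end
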